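import Literature.RingTheory.FormalGroups.DrinfeldCocycle
import Mathlib.RingTheory.DiscreteValuationRing.Basic
import Mathlib.RingTheory.LocalRing.ResidueField.Basic
import Mathlib.FieldTheory.Finite.Basic
import Mathlib.Algebra.CharP.Reduced
import Mathlib.Algebra.Polynomial.Roots
import Mathlib.Tactic.LinearCombination
import HarnessLib

/-!
# Drinfeld's key lemma, part II: the hard case and the lifting of Drinfeld cocycles along surjections
# ([Drinfeld 1974] §1, proof of Prop. 1.4 «Λ̃_𝒪^n ≅ 𝒪»; [Hazewinkel 1978] §21.4)

Topic `Literature/RingTheory/FormalGroups`; namespace `Literature.RingTheory.FormalGroups`.  Fully proved theorems; no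
definition, no named fact, no instance, no notation, no `sorry`.  Cell `hodgecm-mathlib`, P6 «MOD programme», sub-line P6d.

Continuation of the sibling `DrinfeldCocycle`.  Let `𝒪` be a local ring with principal maximal ideal `𝔪 = (ϖ)` and FINITE
residue field `k` of characteristic `p`, `m ≥ 2`, and suppose we are in Drinfeld's HARD CASE: `ν(m) ∈ 𝔪` and `u^m − u ∈ 𝔪`
for all `u` (equivalently `m = q^h`, `q = #k`).

* `IsDrinfeldCocycle.eq_zero_of_apply_eq_zero` — a Drinfeld cocycle `(c, δ)` with `δ ϖ = 0` VANISHES: `ϖ·δ = 0`, `ϖ·c = 0`,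
  `δ(ϖ𝒪) = 0`, `δ` descends mod `ϖ`; `δ(x^p) = p·x^{p−1}·δ x = 0` and surjectivity of Frobenius on `k` give `δ = 0`; then
  `C_m(a,b)·c = 0` for all `a, b` and — `m = p^h`, `C_{p^h} ≡ C_p ∘ Frob^{h−1} (mod p)` (sibling `CocyclePolynomialFrobenius`),
  `deg_T C_p(1,T) = p − 1 < #k` — some `C_m(1,y)` is a unit, so `c = 0`.
* `IsDrinfeldCocycle.exists_eq_of_dvr` — over a DVR with finite residue field of characteristic `p`, EVERY Drinfeld cocycle
  of degree `m ≥ 2` is a standard one `(qν·d, q(a)·d)` for the divisor `w = 1` (easy cases) or `w = ϖ^m − ϖ` (hard case, with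
  `d = δ ϖ`).  This is «`Λ̃_𝒪^{m−1}` is generated by one element» of Drinfeld's proof.
* `IsDrinfeldCocycle.exists_lift` — CONSEQUENCE USED BY THE BUD-LIFTING: Drinfeld cocycles lift along every surjective
  `𝒪`-linear map `N′ ↠ N`.

Completeness of `𝒪` is NOT used (Drinfeld states Prop. 1.4 for the ring of integers of a local field).

Deliberately NOT here: power series, the universal formal `𝒪`-module.
-/

namespace Literature.RingTheory.FormalGroups

open Finset IsLocalRing Polynomial

universe u v

/-! ## §1 A non-root of `C_p(1,T)` in a finite field of characteristic `p` -/

/-- Over a finite field `k` of characteristic `p`, `T ↦ C_p(1,T)` does not vanish identically: it is a polynomial of degree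
`p − 1` (coefficient of `T^{p−1}` equal to `cocycleCoeff p 1 = 1`) and `p − 1 < p ≤ #k`. [cite: Drinfeld1974, §1 Prop. 1.4 (proof)] -/
theorem exists_cocyclePolyEval_prime_one_ne_zero (k : Type*) [Field k] [Fintype k] (p : ℕ) [hp : Fact p.Prime] [CharP k p] :
    ∃ z : k, cocyclePolyEval k p 1 z ≠ 0 := by
  classical
  -- the polynomial `P(T) = Σ_{i ≤ p} c_{p,i} T^{p−i}`
  let P : k[X] := ∑ i ∈ range (p + 1), C (cocycleCoeff p i : k) * X ^ (p - i)
  have hPeval : ∀ z : k, P.eval z = cocyclePolyEval k p 1 z := fun z => by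
    simp only [P, eval_finsetSum, eval_mul, eval_C, eval_pow, eval_X, cocyclePolyEval, one_pow, mul_one]
  have hdeg : P.natDegree ≤ p - 1 := by
    refine natDegree_sum_le_of_forall_le _ _ fun i hi => ?_
    rcases Nat.eq_zero_or_pos i with rfl | hi0
    · simp
    · exact (natDegree_C_mul_X_pow_le _ _).trans (by omega)
  have hcoeff : P.coeff (p - 1) = 1 := by
    rw [finsetSum_coeff, Finset.sum_eq_single 1]
    · rw [coeff_C_mul_X_pow, if_pos rfl, cocycleCoeff_prime_one hp.out, Nat.cast_one]
    · intro i hi hi1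
      rw [coeff_C_mul_X_pow, if_neg]
      have hp2 := hp.out.two_le
      have := Finset.mem_range.1 hi
      omega
    · intro h; exact absurd (Finset.mem_range.2 (by have := hp.out.two_le; omega)) h
  have hP0 : P ≠ 0 := fun h => by
    have := hcoeff; rw [h, coeff_zero] at this; exact zero_ne_one this
  by_contra hall
  simp only [ne_eq, not_exists, not_not] at hall
  obtain ⟨n, -, hcard⟩ := FiniteField.card k p
  refine hP0 (eq_zero_of_natDegree_lt_card_of_eval_eq_zero P Function.injective_id (fun z => ?_) ?_)
  · rw [id, hPeval, hall]
  · calc P.natDegree ≤ p - 1 := hdeg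
      _ < p ^ 1 := by rw [pow_one]; have := hp.out.pos; omega
      _ ≤ p ^ (n : ℕ) := Nat.pow_le_pow_right hp.out.pos n.pos
      _ = Fintype.card k := hcard.symm

/-! ## §2 The hard case: vanishing -/

section HardCase

variable {𝒪 : Type u} [CommRing 𝒪] [IsLocalRing 𝒪] {N : Type v} [AddCommGroup N] [Module 𝒪 N]

/-- In Drinfeld's hard case, a Drinfeld cocycle with `δ ϖ = 0` satisfies `ϖ·δ a = 0`, `δ (ϖ·a) = 0` and `ϖ·c = 0`.
[cite: Drinfeld1974, §1 Prop. 1.4 (proof)] -/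
theorem IsDrinfeldCocycle.uniformizer_smul_eq_zero {ϖ : 𝒪} (hϖ𝔪 : ϖ ∈ maximalIdeal 𝒪) {m : ℕ} (hm : 2 ≤ m)
    {c : N} {δ : 𝒪 → N} (h : IsDrinfeldCocycle m c δ) (hδϖ : δ ϖ = 0) :
    (∀ a, ϖ • δ a = 0) ∧ (∀ a, δ (ϖ * a) = 0) ∧ ((lazardNu m : 𝒪) ∈ maximalIdeal 𝒪 → ϖ • c = 0) := by
  -- `ϖ^m − ϖ = ϖ·e₁` with `e₁ = ϖ^{m−1} − 1` a unit
  have he₁ : IsUnit (ϖ ^ (m - 1) - 1) := by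
    have : ϖ ^ (m - 1) ∈ maximalIdeal 𝒪 := Ideal.pow_mem_of_mem _ hϖ𝔪 _ (by omega)
    have hu := IsLocalRing.isUnit_or_isUnit_one_sub_self (ϖ ^ (m - 1))
    rcases hu with hu | hu
    · exact absurd hu (by simpa using this)
    · rw [← IsUnit.neg_iff, neg_sub]; exact hu
  obtain ⟨e, he⟩ := he₁.exists_left_inv
  have hw : ϖ ^ m - ϖ = ϖ * (ϖ ^ (m - 1) - 1) := by
    rw [mul_sub, mul_one, ← pow_succ', show m - 1 + 1 = m by omega]
  have hs1 : ∀ a, ϖ • δ a = 0 := fun a => by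
    have := h.pow_sub_smul_comm a ϖ
    rw [hδϖ, smul_zero, hw, mul_comm, mul_smul] at this
    -- this : (ϖ^{m-1} − 1) • ϖ • δ a = 0
    have := congrArg (e • ·) this
    simpa [smul_smul, ← mul_assoc, he] using this
  refine ⟨hs1, fun a => h.apply_mul_eq_zero hδϖ (hs1 a), fun hν => ?_⟩
  have := h.nu_smul ϖ
  rw [hδϖ, smul_zero, hw, mul_comm, mul_smul] at this
  have := congrArg (e • ·) this.symm
  simpa [smul_smul, ← mul_assoc, he] using this

/-- **Vanishing in the hard case.**  `𝒪` local with maximal ideal `(ϖ)` and finite residue field of characteristic `p`;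
`m ≥ 2` with `ν(m) ∈ 𝔪` and `u^m − u ∈ 𝔪` for all `u`.  Then a Drinfeld cocycle `(c, δ)` of degree `m` with `δ ϖ = 0` is zero.
[cite: Drinfeld1974, §1 Prop. 1.4 (proof)] -/
theorem IsDrinfeldCocycle.eq_zero_of_apply_eq_zero (p : ℕ) [hp : Fact p.Prime] [CharP (ResidueField 𝒪) p]
    [Finite (ResidueField 𝒪)] {ϖ : 𝒪} (hϖ : maximalIdeal 𝒪 = Ideal.span {ϖ}) {m : ℕ} (hm : 2 ≤ m)
    (hν : (lazardNu m : 𝒪) ∈ maximalIdeal 𝒪) (hpow : ∀ u : 𝒪, u ^ m - u ∈ maximalIdeal 𝒪)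
    {c : N} {δ : 𝒪 → N} (h : IsDrinfeldCocycle m c δ) (hδϖ : δ ϖ = 0) : c = 0 ∧ ∀ a, δ a = 0 := by
  have hϖ𝔪 : ϖ ∈ maximalIdeal 𝒪 := hϖ ▸ Ideal.mem_span_singleton_self ϖ
  have hdvd : ∀ {x : 𝒪}, x ∈ maximalIdeal 𝒪 → ∃ y, x = ϖ * y := fun hx => by
    rw [hϖ, Ideal.mem_span_singleton] at hx; exact hx
  obtain ⟨hs1, hs2, hs3⟩ := h.uniformizer_smul_eq_zero hϖ𝔪 hm hδϖ
  have hϖc : ϖ • c = 0 := hs3 hν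
  -- (s4) `δ` only depends on the class mod `ϖ`
  have hs4 : ∀ a b : 𝒪, δ (a + ϖ * b) = δ a := fun a b => by
    rw [h.delta_add, hs2, add_zero]
    obtain ⟨t, ht⟩ := dvd_cocyclePolyEval_right m a (ϖ * b)
    rw [ht, mul_assoc, mul_comm ϖ (b * t), mul_smul, hϖc, smul_zero, add_zero]
  -- (s5) `δ (x^{n+1}) = ((n+1)·x^n) • δ x`, hence `δ (x^p) = 0`
  have hs5 : ∀ x : 𝒪, ∀ n : ℕ, δ (x ^ (n + 1)) = (((n + 1 : ℕ) : 𝒪) * x ^ n) • δ x := by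
    intro x n
    induction n with
    | zero => simp
    | succ n ih =>
      rw [pow_succ', h.delta_mul, ih, smul_smul, ← add_smul]
      -- `x^{(n+1)m} ≡ x^{n+1} (mod ϖ)` and `ϖ·δ x = 0`
      obtain ⟨t, ht⟩ : ∃ t, (x ^ (n + 1)) ^ m - x ^ (n + 1) = ϖ * t := by
        obtain ⟨y, hy⟩ := hdvd (hpow x)
        obtain ⟨s, hs⟩ := sub_dvd_pow_sub_pow (x ^ m) x (n + 1)
        refine ⟨y * s, ?_⟩
        rw [← pow_mul, mul_comm (n + 1) m, pow_mul, hs, hy, mul_assoc]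
      have hxm : (x ^ (n + 1)) ^ m • δ x = x ^ (n + 1) • δ x := by
        rw [← sub_eq_zero, ← sub_smul, ht, mul_comm, mul_smul, hs1, smul_zero]
      rw [add_smul, hxm, ← add_smul]
      congr 1
      push_cast
      ring
  have hp𝔪 : (p : 𝒪) ∈ maximalIdeal 𝒪 := by
    rw [← residue_eq_zero_iff, map_natCast, CharP.cast_eq_zero]
  have hs5' : ∀ x : 𝒪, δ (x ^ p) = 0 := fun x => by
    obtain ⟨p', hp'⟩ := hdvd hp𝔪
    have := hs5 x (p - 1)
    rw [show p - 1 + 1 = p from Nat.sub_add_cancel hp.out.pos] at this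
    rw [this, hp', mul_assoc, mul_comm, mul_smul, hs1, smul_zero]
  -- (s6) `δ = 0` by surjectivity of Frobenius on the residue field
  haveI := Fintype.ofFinite (ResidueField 𝒪)
  have hfrob : Function.Surjective (frobenius (ResidueField 𝒪) p) :=
    Finite.surjective_of_injective (frobenius_inj (ResidueField 𝒪) p)
  have hδ : ∀ a, δ a = 0 := fun a => by
    obtain ⟨yb, hyb⟩ := hfrob (residue 𝒪 a)
    obtain ⟨y, rfl⟩ := residue_surjective yb
    rw [frobenius_def, ← map_pow] at hyb
    obtain ⟨b, hb⟩ : ∃ b, a - y ^ p = ϖ * b := hdvd (by rw [← residue_eq_zero_iff, map_sub, hyb, sub_self])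
    rw [show a = y ^ p + ϖ * b by rw [← hb]; ring, hs4, hs5']
  refine ⟨?_, hδ⟩
  -- (s7) `c = 0`: `m = p^h` and some `C_m(1,y)` is a unit
  have hν1 : lazardNu m ≠ 1 := fun h1 => by
    rw [h1, Nat.cast_one] at hν; exact (maximalIdeal.isMaximal 𝒪).ne_top (Ideal.eq_top_of_isUnit_mem _ hν isUnit_one)
  have hppow : IsPrimePow m := by
    by_contra hnp; exact hν1 (lazardNu_of_not_isPrimePow hnp)
  obtain ⟨ℓ, e, hℓ, he, rfl⟩ := (isPrimePow_nat_iff m).1 hppow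
  rw [lazardNu_prime_pow hℓ he] at hν
  have hℓp : ℓ = p := by
    have h0 : (ℓ : ResidueField 𝒪) = 0 := by rw [← map_natCast (residue 𝒪), residue_eq_zero_iff]; exact hν
    rw [CharP.cast_eq_zero_iff (ResidueField 𝒪) p] at h0
    exact ((Nat.prime_dvd_prime_iff_eq hp.out hℓ).1 h0).symm
  subst hℓp
  obtain ⟨z, hz⟩ := exists_cocyclePolyEval_prime_one_ne_zero (ResidueField 𝒪) ℓ
  obtain ⟨yb, hyb⟩ := (hfrob.iterate (e - 1)) z
  obtain ⟨y, rfl⟩ := residue_surjective yb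
  rw [iterate_frobenius] at hyb
  have hunit : IsUnit (cocyclePolyEval 𝒪 (ℓ ^ e) 1 y) := by
    rw [← residue_ne_zero_iff_isUnit, map_cocyclePolyEval, map_one,
      cocyclePolyEval_prime_pow_eq_of_charP (ResidueField 𝒪) he, one_pow, hyb]
    exact hz
  obtain ⟨v, hv⟩ := hunit.exists_left_inv
  have hadd := h.delta_add 1 y
  rw [hδ, hδ, hδ, zero_add, zero_add] at hadd
  -- hadd : 0 = C_m(1,y) • c
  have := congrArg (v • ·) hadd
  simpa [smul_smul, hv] using this.symm

end HardCase

/-! ## §3 Classification over a DVR with finite residue field, and lifting -/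

section DVR

variable {𝒪 : Type u} [CommRing 𝒪] [IsDomain 𝒪] [IsDiscreteValuationRing 𝒪]

/-- **Drinfeld's key lemma (classification form).**  `𝒪` a DVR with finite residue field of characteristic `p`, `m ≥ 2`.
There are `w, qν ∈ 𝒪`, `q : 𝒪 → 𝒪` with `w` nonzero, `w·qν = ν(m)`, `w·q(a) = a^m − a`, such that EVERY Drinfeld cocycle of
degree `m` over EVERY `𝒪`-module is `(qν·d, a ↦ q(a)·d)` for some `d` («`Λ̃^{m−1}_𝒪 ≅ 𝒪`»).  (`w = 1` unless `ν(m)` and all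
`u^m − u` lie in `𝔪`, in which case `w = ϖ^m − ϖ`.) [cite: Drinfeld1974, §1 Prop. 1.4 (proof)] [cite: Hazewinkel1978, §21.4] -/
theorem IsDrinfeldCocycle.exists_generator (p : ℕ) [Fact p.Prime] [CharP (ResidueField 𝒪) p] [Finite (ResidueField 𝒪)]
    {m : ℕ} (hm : 2 ≤ m) :
    ∃ (w qν : 𝒪) (q : 𝒪 → 𝒪), IsRegular w ∧ w * qν = lazardNu m ∧ (∀ a, w * q a = a ^ m - a) ∧
      ∀ (N : Type v) [AddCommGroup N] [Module 𝒪 N] (c : N) (δ : 𝒪 → N), IsDrinfeldCocycle m c δ →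
        ∃ d : N, c = qν • d ∧ ∀ a, δ a = q a • d := by
  classical
  by_cases hA : IsUnit (lazardNu m : 𝒪)
  · exact ⟨1, lazardNu m, fun a => a ^ m - a, isRegular_one, one_mul _, fun a => one_mul _,
      fun N _ _ c δ h => h.exists_eq_standard_of_isUnit_lazardNu hA⟩
  by_cases hB : ∃ u : 𝒪, IsUnit (u ^ m - u)
  · obtain ⟨u, hu⟩ := hB
    exact ⟨1, lazardNu m, fun a => a ^ m - a, isRegular_one, one_mul _, fun a => one_mul _,
      fun N _ _ c δ h => h.exists_eq_standard_of_isUnit_pow_sub hu⟩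
  -- the hard case
  simp only [not_exists] at hB
  obtain ⟨ϖ, hϖirr⟩ := IsDiscreteValuationRing.exists_irreducible 𝒪
  have hϖ : maximalIdeal 𝒪 = Ideal.span {ϖ} := (IsDiscreteValuationRing.irreducible_iff_uniformizer ϖ).1 hϖirr
  have hϖ𝔪 : ϖ ∈ maximalIdeal 𝒪 := hϖ ▸ Ideal.mem_span_singleton_self ϖ
  have hν : (lazardNu m : 𝒪) ∈ maximalIdeal 𝒪 := (mem_maximalIdeal _).2 hA
  have hpow : ∀ u : 𝒪, u ^ m - u ∈ maximalIdeal 𝒪 := fun u => (mem_maximalIdeal _).2 (hB u)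
  have hdvd : ∀ {x : 𝒪}, x ∈ maximalIdeal 𝒪 → ∃ y, x = ϖ * y := fun hx => by
    rw [hϖ, Ideal.mem_span_singleton] at hx; exact hx
  -- `w = ϖ^m − ϖ = ϖ·e₁`, `e₁` a unit
  have he₁ : IsUnit (ϖ ^ (m - 1) - 1) := by
    have : ϖ ^ (m - 1) ∈ maximalIdeal 𝒪 := Ideal.pow_mem_of_mem _ hϖ𝔪 _ (by omega)
    rcases IsLocalRing.isUnit_or_isUnit_one_sub_self (ϖ ^ (m - 1)) with hu | hu
    · exact absurd hu (by simpa using this)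
    · rw [← IsUnit.neg_iff, neg_sub]; exact hu
  obtain ⟨e, he⟩ := he₁.exists_left_inv
  have hw : ϖ ^ m - ϖ = ϖ * (ϖ ^ (m - 1) - 1) := by
    rw [mul_sub, mul_one, ← pow_succ', show m - 1 + 1 = m by omega]
  have hw0 : ϖ ^ m - ϖ ≠ 0 := by
    rw [hw]; exact mul_ne_zero hϖirr.ne_zero he₁.ne_zero
  -- quotients
  have hqν' : ∃ qν, (ϖ ^ m - ϖ) * qν = lazardNu m := by
    obtain ⟨y, hy⟩ := hdvd hν
    exact ⟨e * y, by rw [hy, hw]; linear_combination (ϖ * y) * he⟩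
  have hq' : ∀ a : 𝒪, ∃ qa, (ϖ ^ m - ϖ) * qa = a ^ m - a := fun a => by
    obtain ⟨y, hy⟩ := hdvd (hpow a)
    exact ⟨e * y, by rw [hy, hw]; linear_combination (ϖ * y) * he⟩
  obtain ⟨qν, hqν⟩ := hqν'
  choose q hq using hq'
  refine ⟨ϖ ^ m - ϖ, qν, q, IsRegular.of_ne_zero hw0, hqν, hq, fun N _ _ c δ h => ?_⟩
  -- subtract the standard cocycle with `d = δ ϖ`; the remainder has `δ₁ ϖ = 0`, hence vanishes
  have h0 := isDrinfeldCocycle_of_div (by omega : 0 < m) (IsRegular.of_ne_zero hw0) hqν hq (δ ϖ)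
  have h1 := h.sub h0
  have hqϖ : q ϖ = 1 := by
    apply (IsRegular.of_ne_zero hw0).left
    dsimp only
    rw [hq ϖ, mul_one]
  have hδ₁ϖ : δ ϖ - q ϖ • δ ϖ = 0 := by rw [hqϖ, one_smul, sub_self]
  obtain ⟨hc, hδ⟩ := h1.eq_zero_of_apply_eq_zero p hϖ hm hν hpow hδ₁ϖ
  exact ⟨δ ϖ, (sub_eq_zero.1 hc), fun a => sub_eq_zero.1 (hδ a)⟩

/-- **Drinfeld cocycles lift along surjections** (`𝒪` a DVR with finite residue field of characteristic `p`, `m ≥ 2`): for a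
surjective `𝒪`-linear `g : N′ → N` and a Drinfeld cocycle `(c, δ)` of degree `m` over `N` there is a Drinfeld cocycle
`(c′, δ′)` over `N′` with `g c′ = c`, `g ∘ δ′ = δ`.  This is the form of Drinfeld's «`Λ̃_𝒪 ≅ 𝒪[…]` is smooth» consumed by the
lifting of formal `𝒪`-module laws. [cite: Drinfeld1974, §1 Prop. 1.4] [cite: Hazewinkel1978, §21.4] -/
theorem IsDrinfeldCocycle.exists_lift (p : ℕ) [Fact p.Prime] [CharP (ResidueField 𝒪) p] [Finite (ResidueField 𝒪)]
    {m : ℕ} (hm : 2 ≤ m) {N N' : Type v} [AddCommGroup N] [Module 𝒪 N] [AddCommGroup N'] [Module 𝒪 N']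
    (g : N' →ₗ[𝒪] N) (hg : Function.Surjective g) {c : N} {δ : 𝒪 → N} (h : IsDrinfeldCocycle m c δ) :
    ∃ (c' : N') (δ' : 𝒪 → N'), IsDrinfeldCocycle m c' δ' ∧ g c' = c ∧ ∀ a, g (δ' a) = δ a := by
  obtain ⟨w, qν, q, hw, hqν, hq, hall⟩ := IsDrinfeldCocycle.exists_generator (𝒪 := 𝒪) p hm
  obtain ⟨d, hc, hδ⟩ := hall N c δ h
  obtain ⟨d', hd'⟩ := hg d
  exact ⟨qν • d', fun a => q a • d', isDrinfeldCocycle_of_div (by omega) hw hqν hq d',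
    by rw [map_smul, hd', hc], fun a => by rw [map_smul, hd', hδ]⟩

end DVR

end Literature.RingTheory.FormalGroups
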